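import Literature.AlgebraicGeometry.Motives.HodgeGroupExteriorPowersMinusIdentityParity
import Literature.AlgebraicGeometry.Motives.MumfordTateGroupInternalEnd
import HarnessLib

/-!
# `−1 · id ∉ Hg(End H)(K)` for EVERY non-zero Hodge structure `H` (the identity is a Hodge class of `End H = Hom(H, H)`), and the parity
# theorem for the TENSOR POWERS `H^{⊗k}` of a polarized `H` of odd weight: `−1 · id ∈ Hg(H^{⊗k})(K)` iff `k` is odd (`k ≤ dim V`)
# (Moonen (5.2) eq. (3) «End(V)^{Hg} = End_HS»; Green–Griffiths–Kerr (I.B.3) `M_{ρ(φ)} = ρ(M_φ)`; Carlson–Müller-Stach–Peters 15.2.4 (ii), 15.2.8 (ii);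
# Lange §7.3.1 Prop. 7.3.3 (proof))

Family `hodge`, lane `lit-hodgefound` (Track 2 foundations library; Layers A2/A3), layer `Literature/AlgebraicGeometry/Motives`, namespace
`Literature.AlgebraicGeometry.Motives.HodgeStructure`.  THEOREMS ONLY (no definition, no named fact; D-0026 net debt `0`).  The two remaining
tensor constructions of GGK (I.B.3) for the seat's `−1 · id` series (g23-#6 `⋀² H`, g23-#7 `⋀ᵏ H`): the internal `End H = H.hom H` (weight `n − n`;
`Motives/HodgeTensor`, `Motives/MumfordTateGroupInternalEnd`) and the tensor powers `H^{⊗k} = H.tensorPower k` (weight `kn`; `Motives/HodgeTensor`),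
into which `⋀ᵏ H` embeds by the morphism `η = Hom.wedgeToTensor H k` (`Motives/HodgeStructureExteriorPowerTensorPower`).

THE PRINTS.  B. Moonen (2004) [Moonen2004MT] §5 (5.2) eq. (3) (the Hodge classes in `End(V)` are the endomorphisms of Hodge structures = the
`Hg`-invariants), (4.4), (5.8).  M. Green, P. Griffiths, M. Kerr (2012) [GreenGriffithsKerr2012] §I.B (I.B.3) (the natural map `ρ : GL(V) → GL(V_ρ)` for a
tensor construction `ρ`, `M_{ρ(φ)} = ρ(M_φ)`), p0035 L33–L35, §V Warning p0154.  J. Carlson, S. Müller-Stach, C. Peters (2017) [CarlsonMullerStachPeters2017]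
§15.2 Examples 15.2.4 (ii) (p0369 L7 «It cannot be trivial since `h(−1) = −1`»), Lemma 15.2.8 (ii) (p0370), Remark (ii) (p0368).  H. Lange (2023)
[Lange2023AbelianVarietiesComplex] §7.3.1, proof of Prop. 7.3.3 (p0337 L13 «spanned by `⋀ᵖ E`, the `p`-fold product of the alternating form
`E ∈ H²(X, ℂ)`»).  W. Greub (1978) [Greub1978Multilinear] §5.3 (`η : ⋀ᵏ V → V^{⊗k}` injective).

THE OBJECTS (all the tree's / Mathlib's).  `H : HodgeStructure V n`; `End H = H.hom H : HodgeStructure (V →ₗ[ℚ] V) (n - n)` and `Hom(H₁, H₂) = H₁.hom H₂`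
(same weight), whose weight-`0` Hodge classes are the morphisms (`mem_hodgeClasses_hom_iff`); the `ℚ`-points homomorphism
`hodgeGroup.endHom H : Hg(H)(ℚ) →* Hg(End H)(ℚ)` (`g ↦ g ∘ · ∘ g⁻¹`); `H^{⊗k} = H.tensorPower k : HodgeStructure (⨂[ℚ]^k V) (k n)`; the morphism
`η = Hom.wedgeToTensor H k : ⋀ᵏ H → H^{⊗k}` (injective); `E_Q^p = ExteriorLefschetz.powOf Q.lefschetzClass p rfl`; `K`-points `Hg(·)(K)`, `MT(·)(K)`,
`ν = Polarization.multiplierChar K`, `−1 · id = LinearEquiv.smulOfUnit (-1)`; `C_ℝ`, `Z(C_ℝ)`, `ℝ^×_{>0} = Units.posSubgroup ℝ`.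

WHAT IS PROVED.
* §1 `End H` / `Hom(H₁, H₂)` (EVERY weight): `Hom.toLinearMap_mem_hodgeClasses_hom_zero` (a morphism is a Hodge class of type `(0,0)` of `Hom(H₁, H₂)`),
  `id_mem_hodgeClasses_hom_self` (`id_V ∈ Hdg⁰(End H)`), **`smulOfUnit_neg_one_not_mem_hodgeGroupBaseChange_hom_of_ne_zero`** (a non-zero morphism
  `H₁ → H₂` excludes `−1 · id` from `Hg(Hom(H₁, H₂))(K)`), **`smulOfUnit_neg_one_not_mem_hodgeGroupBaseChange_hom_self`** (`−1 · id ∉ Hg(End H)(K)` for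
  `V ≠ 0`), `smulOfUnit_neg_one_not_mem_hodgeGroup_hom_self` (`ℚ`-points); versus `hodgeGroup_endHom_neg_one` (`g ↦ g ∘ · ∘ g⁻¹` kills `−1 · id ∈ Hg(H)(ℚ)`,
  odd weight) and `hodgeGroup_endHom_not_injective`.
* §2 `H^{⊗k}` (`H` polarized of ODD weight `n`, `dim_ℚ V = 2g`): `Polarization.wedgeToTensor_powOf_lefschetzClass_mem_hodgeClasses` (`η(E_Q^p) ∈ Hdg^{pn}(H^{⊗2p})`,
  every weight), `Polarization.wedgeToTensor_powOf_lefschetzClass_ne_zero` (`p ≤ g`), **`Polarization.smulOfUnit_neg_one_not_mem_hodgeGroupBaseChange_tensorPower_two_mul`**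
  (`−1 · id ∉ Hg(H^{⊗2p})(K)`, `p ≤ g`), `smulOfUnit_neg_one_mem_hodgeGroupBaseChange_tensorPower_of_odd` (`k` odd),
  **`Polarization.smulOfUnit_neg_one_mem_hodgeGroupBaseChange_tensorPower_iff`** (`k ≤ 2g`: `↔ k` odd), `nontrivial_tensorPower_of_le_finrank`.
* §3 CONSEQUENCES for `H^{⊗k}`, `1 ≤ k ≤ 2g`: `Polarization.ker_multiplierChar_tensorPower_eq_subgroupOf_iff` (Moonen's `Ker ν = Hg(H^{⊗k})(K)` iff `k` odd),
  `Polarization.relIndex_hodgeGroupBaseChange_ker_multiplierChar_tensorPower_eq_one_iff`; shapes: `nonempty_mumfordTateGroupBaseChange_tensorPower_two_mul_mulEquiv_units_prod_of_isAlgClosed`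
  (`MT(H^{⊗2p})(L) ≃* L^× × Hg(H^{⊗2p})(L)`), `nonempty_inf_centralizer_tensorPower_two_mul_mulEquiv_units_prod` (`ℝ^×` shape),
  `nonempty_inf_centralizer_tensorPower_mulEquiv_posSubgroup_prod_of_odd` (`ℝ^×_{>0}` shape, `k` odd).

DEVIATIONS / SCOPE.  ON POINTS, Tannaka-free.  §1 holds in every weight (in weight `n − n = 0` the index / shape statements of the series, which need
weight `≠ 0`, are not claimed for `End H`); the `End`-kill statement is on `ℚ`-points (the tree's `hodgeGroup.endHom`).  §2–§3 assume `H` polarized of odd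
weight (in even weight `E_Q = 0`).

## References
* [Moonen2004MT] B. Moonen, *An introduction to Mumford–Tate groups* (2004) — (4.4), §5 (5.2) eq. (3), (5.8).
* [GreenGriffithsKerr2012] M. Green, P. A. Griffiths, M. Kerr, *Mumford–Tate Groups and Domains* (2012) — §I.B (I.B.3), p. 35, §V Warning p. 154.
* [CarlsonMullerStachPeters2017] J. Carlson, S. Müller-Stach, C. Peters, *Period Mappings and Period Domains*, 2nd ed. (2017) — §15.2 Remark (ii) (p. 368),
  Examples 15.2.4 (ii) (p. 369), Lemma 15.2.8 (ii) (p. 370).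
* [Lange2023AbelianVarietiesComplex] H. Lange, *Abelian Varieties over the Complex Numbers* (2023) — §7.3.1 Prop. 7.3.3 (proof, p. 337).
* [Greub1978Multilinear] W. Greub, *Multilinear Algebra*, 2nd ed. (1978) — §5.3.
* [DeligneHodgeII1971] P. Deligne, *Théorie de Hodge II* (1971) — 1.1.6, 1.1.12 (morphisms; tensor constructions).

## Provenance
Lane `lit-hodgefound` (Hodge path, Track 2), prover seat `lit-hodgefound-p29` (generation 23), self-proposed row g23-#8 (End / tensor-power sequel of g23-#6/#7).
-/

noncomputable section

open scoped TensorProduct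
open Module

namespace Literature.AlgebraicGeometry.Motives

namespace HodgeStructure

open ExteriorLefschetz

universe u w

/-- `id_V ≠ 0` for `V ≠ 0`. [folklore] -/
private theorem linearMap_id_ne_zero {V : Type u} [AddCommGroup V] [Module ℚ V] [Nontrivial V] :
    (LinearMap.id : V →ₗ[ℚ] V) ≠ 0 := fun h ↦ by
  obtain ⟨v, hv⟩ := exists_ne (0 : V)
  exact hv (by simpa using LinearMap.congr_fun h v)

/-! ### §1 `End H` and `Hom(H₁, H₂)`: a non-zero morphism excludes `−1 · id` -/

section InternalHom

variable (K : Type w) [Field K] [Algebra ℚ K] {V : Type u} [AddCommGroup V] [Module ℚ V] [Module.Finite ℚ V]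
  {W : Type u} [AddCommGroup W] [Module ℚ W] [Module.Finite ℚ W] [HodgeTensorFacts.{u, u}] {n : ℤ}
  {H : HodgeStructure V n} {H₁ : HodgeStructure V n} {H₂ : HodgeStructure W n}

omit [Module.Finite ℚ W] in
/-- **A morphism of Hodge structures is a Hodge class of type `(0, 0)` of `Hom(H₁, H₂)`** (the tree's `mem_hodgeClasses_hom_iff`; Moonen (5.2) eq. (3),
Deligne 1.1.6). [cite: Moonen2004MT, §5 (5.2) eq. (3)] [cite: DeligneHodgeII1971, 1.1.6] -/
theorem Hom.toLinearMap_mem_hodgeClasses_hom_zero (f : Hom H₁ H₂) : f.toLinearMap ∈ (H₁.hom H₂).hodgeClasses 0 :=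
  (mem_hodgeClasses_hom_iff H₁ H₂ f.toLinearMap).2 f.map_F_le

/-- **`id_V ∈ Hdg⁰(End H)`**: the identity is a Hodge class of the internal `End H = Hom(H, H)`. [cite: Moonen2004MT, §5 (5.2) eq. (3)] -/
theorem id_mem_hodgeClasses_hom_self (H : HodgeStructure V n) : (LinearMap.id : V →ₗ[ℚ] V) ∈ (H.hom H).hodgeClasses 0 :=
  (Hom.id H).toLinearMap_mem_hodgeClasses_hom_zero

/-- **A non-zero morphism `f : H₁ → H₂` excludes `−1 · id` from `Hg(Hom(H₁, H₂))(K)`** (every field `K ⊇ ℚ`): `Hg(Hom(H₁, H₂))(K)` fixes the non-zero Hodge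
class `1 ⊗ f` of type `(0, 0)` of the weight-`0` structure `Hom(H₁, H₂)` (p02's `smulOfUnit_neg_one_not_mem_hodgeGroupBaseChange_of_mem_hodgeClasses`).
[cite: Moonen2004MT, (4.4) and §5 (5.2) eq. (3)] [cite: CarlsonMullerStachPeters2017, §15.2 Lemma 15.2.8 (ii)] -/
theorem smulOfUnit_neg_one_not_mem_hodgeGroupBaseChange_hom_of_ne_zero (f : Hom H₁ H₂) (hf : f.toLinearMap ≠ 0) :
    (LinearEquiv.smulOfUnit (-1 : Kˣ) : (K ⊗[ℚ] (V →ₗ[ℚ] W)) ≃ₗ[K] (K ⊗[ℚ] (V →ₗ[ℚ] W))) ∉ (H₁.hom H₂).hodgeGroupBaseChange K :=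
  smulOfUnit_neg_one_not_mem_hodgeGroupBaseChange_of_mem_hodgeClasses K (H₁.hom H₂) (k := 0) (by simp) f.toLinearMap_mem_hodgeClasses_hom_zero hf

/-- **`−1 · id ∉ Hg(End H)(K)` for every non-zero Hodge structure `H`** (every weight, every field `K ⊇ ℚ`): `Hg(End H)(K)` fixes `1 ⊗ id_V`.
[cite: Moonen2004MT, (4.4) and §5 (5.2) eq. (3)] [cite: CarlsonMullerStachPeters2017, §15.2 Lemma 15.2.8 (ii)] [cite: GreenGriffithsKerr2012, §I.B (I.B.3)] -/
theorem smulOfUnit_neg_one_not_mem_hodgeGroupBaseChange_hom_self [Nontrivial V] (H : HodgeStructure V n) :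
    (LinearEquiv.smulOfUnit (-1 : Kˣ) : (K ⊗[ℚ] (V →ₗ[ℚ] V)) ≃ₗ[K] (K ⊗[ℚ] (V →ₗ[ℚ] V))) ∉ (H.hom H).hodgeGroupBaseChange K :=
  smulOfUnit_neg_one_not_mem_hodgeGroupBaseChange_hom_of_ne_zero K (Hom.id H) linearMap_id_ne_zero

/-- **`ℚ`-points: `−1 · id ∉ Hg(End H)(ℚ)`** (`V ≠ 0`, every weight). [cite: Moonen2004MT, (4.4) and §5 (5.2) eq. (3)] -/
theorem smulOfUnit_neg_one_not_mem_hodgeGroup_hom_self [Nontrivial V] (H : HodgeStructure V n) :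
    (LinearEquiv.smulOfUnit (-1 : ℚˣ) : (V →ₗ[ℚ] V) ≃ₗ[ℚ] (V →ₗ[ℚ] V)) ∉ (H.hom H).hodgeGroup :=
  smulOfUnit_neg_one_not_mem_hodgeGroup_of_mem_hodgeClasses (H.hom H) (k := 0) (by simp) (id_mem_hodgeClasses_hom_self H) linearMap_id_ne_zero

/-- **`g ↦ g ∘ · ∘ g⁻¹` kills the sign**: in odd weight `−1 · id ∈ Hg(H)(ℚ)` (the tree's `smulOfUnit_neg_one_mem_hodgeGroup`) lies in the kernel of
`Hg(H)(ℚ) → Hg(End H)(ℚ)` (it is central in `End(V)`, the tree's `hodgeGroup.mem_ker_endHom_iff`). [cite: Moonen2004MT, §5 (5.2) eq. (3)]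
[cite: CarlsonMullerStachPeters2017, §15.2 Examples 15.2.4 (ii)] -/
theorem hodgeGroup_endHom_neg_one (H : HodgeStructure V n) (hn : Odd n) :
    hodgeGroup.endHom H ⟨LinearEquiv.smulOfUnit (-1 : ℚˣ), smulOfUnit_neg_one_mem_hodgeGroup H hn⟩ = 1 := by
  rw [← MonoidHom.mem_ker, hodgeGroup.mem_ker_endHom_iff]
  intro f
  ext v
  simp [LinearEquiv.smulOfUnit]

/-- **`Hg(H)(ℚ) → Hg(End H)(ℚ)` is NOT injective** in odd weight (`V ≠ 0`): `−1 · id ≠ 1` is in its kernel — on points GGK's `M_{ρ(φ)} = ρ(M_φ)` for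
`ρ = End` is a proper quotient. [cite: GreenGriffithsKerr2012, §I.B (I.B.3)] [cite: Moonen2004MT, §5 (5.2) eq. (3)] -/
theorem hodgeGroup_endHom_not_injective [Nontrivial V] (H : HodgeStructure V n) (hn : Odd n) :
    ¬ Function.Injective (hodgeGroup.endHom H) := fun hinj ↦ by
  have h := congrArg Subtype.val (hinj ((hodgeGroup_endHom_neg_one H hn).trans (map_one _).symm))
  obtain ⟨v, hv⟩ := exists_ne (0 : V)
  have h2 : (((-1 : ℚˣ) : ℚ) • v : V) = v := LinearEquiv.congr_fun h v
  rw [Units.val_neg, Units.val_one, neg_one_smul] at h2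
  have h3 : (2 : ℚ) • v = 0 := by
    rw [two_smul]
    nth_rewrite 1 [← h2]
    exact neg_add_cancel v
  exact hv ((smul_eq_zero.1 h3).resolve_left two_ne_zero)

end InternalHom

/-! ### §2 The tensor powers `H^{⊗k}`: `η(E_Q^p)` is a non-zero Hodge class of `H^{⊗2p}`; parity -/

section TensorPower

variable (K : Type w) [Field K] [Algebra ℚ K] {V : Type u} [AddCommGroup V] [Module ℚ V] [Module.Finite ℚ V] [HodgeTensorFacts.{u, u}]
  {n : ℤ} {H : HodgeStructure V n}

omit [Module.Finite ℚ V] [HodgeTensorFacts.{u, u}] in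
/-- A morphism of pure Hodge structures of the same weight maps `Hdgᵖ` to `Hdgᵖ` (`φ_ℂ(1 ⊗ v) = 1 ⊗ φ v`, `φ_ℂ(Fᵖ) ⊆ Fᵖ`). [folklore] -/
private theorem Hom.apply_mem_hodgeClasses₈ {W : Type u} [AddCommGroup W] [Module ℚ W] {m : ℤ} {H₁ : HodgeStructure V m}
    {H₂ : HodgeStructure W m} (φ : Hom H₁ H₂) {p : ℤ} {v : V} (hv : v ∈ H₁.hodgeClasses p) : φ.toLinearMap v ∈ H₂.hodgeClasses p := by
  rw [mem_hodgeClasses_iff] at hv ⊢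
  have h : φ.toLinearMap.baseChange ℂ (ofRat v) = ofRat (φ.toLinearMap v) := by
    rw [ofRat_apply, ofRat_apply, LinearMap.baseChange_tmul]
  rw [← h]
  exact φ.map_F_le p ⟨_, hv, rfl⟩

/-- **`η(E_Q^p) ∈ Hdg^{pn}(H^{⊗2p})`**: the image of the Hodge class `E_Q^p` of `⋀^{2p} H` under the morphism `η : ⋀^{2p} H → H^{⊗2p}` (every weight).
[cite: Lange2023AbelianVarietiesComplex, §7.3.1 Prop. 7.3.3 (proof, p. 337)] [cite: DeligneHodgeII1971, 1.1.12] -/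
theorem Polarization.wedgeToTensor_powOf_lefschetzClass_mem_hodgeClasses (Q : Polarization H) (p : ℕ) :
    (Hom.wedgeToTensor H (2 * p)).toLinearMap (powOf Q.lefschetzClass p rfl) ∈ (H.tensorPower (2 * p)).hodgeClasses (p * n) :=
  Hom.apply_mem_hodgeClasses₈ (Hom.wedgeToTensor H (2 * p)) (Q.powOf_lefschetzClass_mem_hodgeClasses p)

omit [HodgeTensorFacts.{u, u}] in
/-- `η(E_Q^p) ≠ 0` for `p ≤ g` (`n` odd, `dim V = 2g`; `η` is injective, Greub §5.3). [cite: Lange2023AbelianVarietiesComplex, §7.3.1 Prop. 7.3.3 (proof, p. 337)]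
[cite: Greub1978Multilinear, §5.3] -/
theorem Polarization.wedgeToTensor_powOf_lefschetzClass_ne_zero (Q : Polarization H) (hn : Odd n) {g : ℕ} (hg : Module.finrank ℚ V = 2 * g)
    {p : ℕ} (hp : p ≤ g) : Motives.HodgeStructure.wedgeToTensor V (2 * p) (powOf Q.lefschetzClass p rfl) ≠ 0 := fun h ↦
  Q.powOf_lefschetzClass_ne_zero hn hg hp (wedgeToTensor_injective (2 * p) (h.trans (map_zero _).symm))

omit [Module.Finite ℚ V] [HodgeTensorFacts.{u, u}] in
/-- The weight of `H^{⊗2p}` is `pn + pn`. [folklore] -/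
private theorem natCast_mul_add_self₈ (p : ℕ) : (p : ℤ) * n + p * n = ((2 * p : ℕ) : ℤ) * n := by
  push_cast
  ring

omit [Module.Finite ℚ V] [HodgeTensorFacts.{u, u}] in
/-- `kn` is odd for `k`, `n` odd. [folklore] -/
private theorem odd_natCast_mul_weight₈ {k : ℕ} (hk : Odd k) (hn : Odd n) : Odd ((k : ℤ) * n) := by
  obtain ⟨a, rfl⟩ := hk
  obtain ⟨b, rfl⟩ := hn
  exact ⟨2 * a * b + a + b, by push_cast; ring⟩

omit [Module.Finite ℚ V] [HodgeTensorFacts.{u, u}] in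
/-- `kn ≠ 0` for `k ≠ 0`, `n` odd. [folklore] -/
private theorem natCast_mul_weight_ne_zero₈ {k : ℕ} (hk : k ≠ 0) (hn : Odd n) : (k : ℤ) * n ≠ 0 := by
  obtain ⟨b, rfl⟩ := hn
  exact mul_ne_zero (Int.natCast_ne_zero.2 hk) (by omega)

/-- **`−1 · id ∉ Hg(H^{⊗2p})(K)` for `p ≤ g`** (`H` polarized of ODD weight, `dim_ℚ V = 2g`, every field `K ⊇ ℚ`): `Hg(H^{⊗2p})(K)` fixes the non-zero
Hodge class `1 ⊗ η(E_Q^p)`, `−1 · id` does not. [cite: Lange2023AbelianVarietiesComplex, §7.3.1 Prop. 7.3.3 (proof, p. 337)] [cite: Moonen2004MT, (4.4)]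
[cite: CarlsonMullerStachPeters2017, §15.2 Lemma 15.2.8 (ii)] [cite: GreenGriffithsKerr2012, §I.B (I.B.3) and §V Warning p. 154] -/
theorem Polarization.smulOfUnit_neg_one_not_mem_hodgeGroupBaseChange_tensorPower_two_mul (Q : Polarization H) (hn : Odd n) {g : ℕ}
    (hg : Module.finrank ℚ V = 2 * g) {p : ℕ} (hp : p ≤ g) :
    (LinearEquiv.smulOfUnit (-1 : Kˣ) : (K ⊗[ℚ] (⨂[ℚ]^(2 * p) V)) ≃ₗ[K] (K ⊗[ℚ] (⨂[ℚ]^(2 * p) V))) ∉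
      (H.tensorPower (2 * p)).hodgeGroupBaseChange K :=
  smulOfUnit_neg_one_not_mem_hodgeGroupBaseChange_of_mem_hodgeClasses K (H.tensorPower (2 * p)) (natCast_mul_add_self₈ p)
    (Q.wedgeToTensor_powOf_lefschetzClass_mem_hodgeClasses p) (Q.wedgeToTensor_powOf_lefschetzClass_ne_zero hn hg hp)

/-- **`−1 · id ∈ Hg(H^{⊗k})(K)` for `k` odd** (`H` of odd weight `n`: the weight `kn` is odd; CMSP's «`h(−1) = −1`»).
[cite: CarlsonMullerStachPeters2017, §15.2 Examples 15.2.4 (ii)] -/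
theorem smulOfUnit_neg_one_mem_hodgeGroupBaseChange_tensorPower_of_odd (H : HodgeStructure V n) (hn : Odd n) {k : ℕ} (hk : Odd k) :
    (LinearEquiv.smulOfUnit (-1 : Kˣ) : (K ⊗[ℚ] (⨂[ℚ]^k V)) ≃ₗ[K] (K ⊗[ℚ] (⨂[ℚ]^k V))) ∈ (H.tensorPower k).hodgeGroupBaseChange K :=
  smulOfUnit_neg_one_mem_hodgeGroupBaseChange K (H.tensorPower k) (odd_natCast_mul_weight₈ hk hn)

/-- **`−1 · id ∈ Hg(H^{⊗k})(K)` iff `k` is odd**, for `k ≤ 2g = dim_ℚ V` (`H` polarized of odd weight).  For `H = H¹(A)`: `Hg(A)(K) ∋ −1` acts through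
`±1` on `H¹(A)^{⊗k}` exactly for `k` even. [cite: Lange2023AbelianVarietiesComplex, §7.3.1 Prop. 7.3.3 (proof, p. 337)] [cite: CarlsonMullerStachPeters2017, §15.2 Examples 15.2.4 (ii)]
[cite: GreenGriffithsKerr2012, §I.B (I.B.3)] -/
theorem Polarization.smulOfUnit_neg_one_mem_hodgeGroupBaseChange_tensorPower_iff (Q : Polarization H) (hn : Odd n) {g : ℕ}
    (hg : Module.finrank ℚ V = 2 * g) {k : ℕ} (hk : k ≤ 2 * g) :
    (LinearEquiv.smulOfUnit (-1 : Kˣ) : (K ⊗[ℚ] (⨂[ℚ]^k V)) ≃ₗ[K] (K ⊗[ℚ] (⨂[ℚ]^k V))) ∈ (H.tensorPower k).hodgeGroupBaseChange K ↔ Odd k := by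
  refine ⟨fun h ↦ ?_, fun h ↦ smulOfUnit_neg_one_mem_hodgeGroupBaseChange_tensorPower_of_odd K H hn h⟩
  by_contra hodd
  obtain ⟨p, rfl⟩ : 2 ∣ k := (Nat.not_odd_iff_even.1 hodd).two_dvd
  exact Q.smulOfUnit_neg_one_not_mem_hodgeGroupBaseChange_tensorPower_two_mul K hn hg (by omega) h

omit [HodgeTensorFacts.{u, u}] in
/-- **`V^{⊗k} ≠ 0` for `k ≤ dim V`** (it contains `η(⋀ᵏ V) ≠ 0`). [cite: Greub1978Multilinear, §5.3] [cite: BourbakiAlgebre1a3, Ch. III §7 no. 8 Cor. 1] -/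
theorem nontrivial_tensorPower_of_le_finrank {k : ℕ} (hk : k ≤ Module.finrank ℚ V) : Nontrivial (⨂[ℚ]^k V) :=
  haveI := nontrivial_exteriorPower_of_le_finrank (V := V) hk
  (wedgeToTensor_injective (V := V) k).nontrivial

end TensorPower

/-! ### §3 Consequences for `H^{⊗k}`: `Ker ν` versus `Hg`, and the shapes on points -/

section Consequences

variable (K : Type w) [Field K] [Algebra ℚ K] {V : Type u} [AddCommGroup V] [Module ℚ V] [Module.Finite ℚ V] [HodgeTensorFacts.{u, u}]
  {n : ℤ} {H : HodgeStructure V n}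

/-- **Moonen's `Ker ν` IS the fixing-group Hodge group of `H^{⊗k}` exactly in odd degree** (`1 ≤ k ≤ 2g`, any polarization `Q_k` of `H^{⊗k}`, any `K`).
[cite: Moonen2004MT, (4.4) and (5.8)] [cite: CarlsonMullerStachPeters2017, §15.2 Remark (ii) after Definition 15.2.1 (p. 368)]
[cite: Lange2023AbelianVarietiesComplex, §7.3.1 Prop. 7.3.3 (proof, p. 337)] -/
theorem Polarization.ker_multiplierChar_tensorPower_eq_subgroupOf_iff (Q : Polarization H) (hn : Odd n) {g : ℕ} (hg : Module.finrank ℚ V = 2 * g)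
    {k : ℕ} (hk0 : k ≠ 0) (hk : k ≤ 2 * g) [Nontrivial (⨂[ℚ]^k V)] (Qk : (H.tensorPower k).Polarization) :
    (Qk.multiplierChar K).ker = ((H.tensorPower k).hodgeGroupBaseChange K).subgroupOf ((H.tensorPower k).mumfordTateGroupBaseChange K) ↔ Odd k := by
  rw [Qk.ker_multiplierChar_eq_subgroupOf_iff K (natCast_mul_weight_ne_zero₈ hk0 hn)]
  exact Q.smulOfUnit_neg_one_mem_hodgeGroupBaseChange_tensorPower_iff K hn hg hk

/-- **`[Ker ν : Hg(H^{⊗k})(K)] = 1` iff `k` is odd** (`1 ≤ k ≤ 2g`; otherwise the index is `2`, g23-#1). [cite: Moonen2004MT, (5.8)]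
[cite: CarlsonMullerStachPeters2017, §15.2 Examples 15.2.4 (ii)] -/
theorem Polarization.relIndex_hodgeGroupBaseChange_ker_multiplierChar_tensorPower_eq_one_iff (Q : Polarization H) (hn : Odd n) {g : ℕ}
    (hg : Module.finrank ℚ V = 2 * g) {k : ℕ} (hk0 : k ≠ 0) (hk : k ≤ 2 * g) [Nontrivial (⨂[ℚ]^k V)] (Qk : (H.tensorPower k).Polarization) :
    (((H.tensorPower k).hodgeGroupBaseChange K).subgroupOf ((H.tensorPower k).mumfordTateGroupBaseChange K)).relIndex (Qk.multiplierChar K).ker = 1 ↔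
      Odd k := by
  rw [Qk.relIndex_hodgeGroupBaseChange_ker_multiplierChar_eq_one_iff K (natCast_mul_weight_ne_zero₈ hk0 hn)]
  exact Q.smulOfUnit_neg_one_mem_hodgeGroupBaseChange_tensorPower_iff K hn hg hk

/-- **Even degree: `MT(H^{⊗2p})(L) ≃* L^× × Hg(H^{⊗2p})(L)` over an algebraically closed `L`**, `1 ≤ p ≤ g` (`H` polarizable of odd weight; `H^{⊗2p}` is
polarizable by the tree's `IsPolarizable.tensorPower`). [cite: GreenGriffithsKerr2012, §I.B p. 35 (semi-direct product remark) and (I.B.3)]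
[cite: CarlsonMullerStachPeters2017, §15.2 Remark (ii) after Definition 15.2.1 (p. 368)] -/
theorem nonempty_mumfordTateGroupBaseChange_tensorPower_two_mul_mulEquiv_units_prod_of_isAlgClosed (L : Type w) [Field L] [Algebra ℚ L]
    [IsAlgClosed L] (hH : H.IsPolarizable) (hn : Odd n) {g : ℕ} (hg : Module.finrank ℚ V = 2 * g) {p : ℕ} (hp0 : p ≠ 0) (hp : p ≤ g) :
    Nonempty ((H.tensorPower (2 * p)).mumfordTateGroupBaseChange L ≃* Lˣ × (H.tensorPower (2 * p)).hodgeGroupBaseChange L) := by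
  obtain ⟨Q⟩ := hH
  haveI : Nontrivial (⨂[ℚ]^(2 * p) V) := nontrivial_tensorPower_of_le_finrank (by omega)
  obtain ⟨Q₂⟩ := IsPolarizable.tensorPower ⟨Q⟩ (2 * p)
  exact Q₂.nonempty_mumfordTateGroupBaseChange_mulEquiv_units_prod_of_isAlgClosed L (natCast_mul_weight_ne_zero₈ (by omega) hn)
    (Q.smulOfUnit_neg_one_not_mem_hodgeGroupBaseChange_tensorPower_two_mul L hn hg hp)

/-- **Even degree: `MT(H^{⊗2p})(ℝ) ∩ Z(C_ℝ) ≃* ℝ^× × (Hg(H^{⊗2p})(ℝ) ∩ Z(C_ℝ))`**, `1 ≤ p ≤ g`.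
[cite: GreenGriffithsKerr2012, §I.B p. 35 (semi-direct product remark) and (I.B.3)] [cite: CarlsonMullerStachPeters2017, §15.2 Remark (ii) after Definition 15.2.1 (p. 368)] -/
theorem nonempty_inf_centralizer_tensorPower_two_mul_mulEquiv_units_prod (hH : H.IsPolarizable) (hn : Odd n) {g : ℕ}
    (hg : Module.finrank ℚ V = 2 * g) {p : ℕ} (hp0 : p ≠ 0) (hp : p ≤ g) :
    Nonempty (↥((H.tensorPower (2 * p)).mumfordTateGroupBaseChange ℝ ⊓ Subgroup.centralizer {(H.tensorPower (2 * p)).realWeilOperator}) ≃*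
      ℝˣ × ↥((H.tensorPower (2 * p)).hodgeGroupBaseChange ℝ ⊓ Subgroup.centralizer {(H.tensorPower (2 * p)).realWeilOperator})) := by
  obtain ⟨Q⟩ := hH
  haveI : Nontrivial (⨂[ℚ]^(2 * p) V) := nontrivial_tensorPower_of_le_finrank (by omega)
  exact nonempty_inf_centralizer_mulEquiv_units_prod_of_neg_one_not_mem _ (natCast_mul_weight_ne_zero₈ (by omega) hn)
    (IsPolarizable.tensorPower ⟨Q⟩ (2 * p)) (Q.smulOfUnit_neg_one_not_mem_hodgeGroupBaseChange_tensorPower_two_mul ℝ hn hg hp)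

/-- **Odd degree: `MT(H^{⊗k})(ℝ) ∩ Z(C_ℝ) ≃* ℝ^×_{>0} × (Hg(H^{⊗k})(ℝ) ∩ Z(C_ℝ))`**, `k` odd, `k ≤ dim V` (`H` polarizable of odd weight).
[cite: GreenGriffithsKerr2012, §I.B p. 35 (semi-direct product remark)] [cite: CarlsonMullerStachPeters2017, §15.2 Examples 15.2.4 (ii)] -/
theorem nonempty_inf_centralizer_tensorPower_mulEquiv_posSubgroup_prod_of_odd (hH : H.IsPolarizable) (hn : Odd n) {k : ℕ} (hk : Odd k)
    (hkV : k ≤ Module.finrank ℚ V) :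
    Nonempty (↥((H.tensorPower k).mumfordTateGroupBaseChange ℝ ⊓ Subgroup.centralizer {(H.tensorPower k).realWeilOperator}) ≃*
      Units.posSubgroup ℝ × ↥((H.tensorPower k).hodgeGroupBaseChange ℝ ⊓ Subgroup.centralizer {(H.tensorPower k).realWeilOperator})) := by
  haveI : Nontrivial (⨂[ℚ]^k V) := nontrivial_tensorPower_of_le_finrank hkV
  exact nonempty_inf_centralizer_mulEquiv_posSubgroup_prod_of_neg_one_mem _ (natCast_mul_weight_ne_zero₈ hk.pos.ne' hn) (hH.tensorPower k)
    (smulOfUnit_neg_one_mem_hodgeGroupBaseChange_tensorPower_of_odd ℝ H hn hk)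

end Consequences

end HodgeStructure

end Literature.AlgebraicGeometry.Motives

end
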